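import Summits.ValiantsHypothesis.ValiantsHypothesis.Theorems.BarrierLeverChowThinRowsTwinPeelPair

/-!
# Route BarrierLever — item `ChowHitsThinRowPartitionMinors` (stmt-ValiantsHypothesis-20195):
# TWIN PEELING V — the recursion with BOTH moves and the first-order-rows slice it certifies

Helper file (`--supports stmt-ValiantsHypothesis-20195`; cell valiant-natproofs, rung V4, 𝒟-side of
door (c); prover seat valiant-natproofs-prover gen 11).  Closes NO item; imports only the seat's
`…ChowThinRowsTwinPeelPair` (parts I–IV; no route file).  Notation (`φ⁰_V`, `B_𝒦`, `E_V`, SPAN,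
POS) as in `…ChowThinRowsTwinPeelSpan`.

THE RECURSION (`exists_forms_of_peeling`).  The successive column families `𝒲s 0, …, 𝒲s p` are
given EXPLICITLY together with, for each stage `t`, the peeled coordinate `cs t` (pairwise distinct)
and a flag: SINGLE stage (part I's move; `𝒲s (t+1) = {W \ cs t}`, at most one twin pair along `cs t`,
cost 1 form `1 + y_{cs t}`) or PAIR stage (part IV's move; `𝒲s (t+1) = {W \ cs t} ∪ {(W \ cs t) \ ds t}`,
the twin bases along `cs t` are among the two columns `w1 t ∋ ds t`, `w2 t ∌ ds t`, cost 2 forms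
`1 + y_{cs t}`, `1 + y_{cs t} + y_{ds t}`); the terminal family is closed by its down-closure (prover
g10's base).  Output: `𝒦` with `|𝒦| ≤ |downclosure (𝒲s p)| + Σ_t cost`, SPAN on `𝒲s 0`, and the full
product a POSITIVE INTEGER on every column (the form of POS that both moves preserve).

THE SLICE (`chowHits_firstOrderRows_of_peeling`): with the budget `≤ h + h`, item 20195's matrix
verbatim is nonsingular on every layout with injective rows of size `≤ 1` and injective columns in
`𝒲s 0`, at every height (via the assembly `chowHits_firstOrderRows_of_spanPos` of part III).

REACH (seat folder lab/peel_k2.py, verify_k2.py): exact at `n = 4` column coordinates and minimal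
height — EVERY family is certified (38 260 / 38 260; parts I–III alone: 36 816; small shadow ∪
affinely independent, the kernel classes before this seat: 16 122); sampled at `n = 5` (150 per `r`,
all coordinates used, minimal `h`): 100 % for `r ≤ 12`, 96 % (`r = 13`), 93 % (14), 77 % (15),
73 % (16).  3 332 designs rebuilt and re-verified numerically (rank + positivity), 0 failures.  The
residue consists of dense families in which some stage meets a coordinate with ≥ 3 twin pairs.

WHAT THIS IS NOT: the first-order-rows slice of item 20195 is NOT proved for all column families (no
move for ≥ 3 twin pairs along every remaining coordinate); nothing on rows of size 2 (val-np-p8), on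
items 20172 / 19717, on crux stmt-ValiantsHypothesis-14610, or on `VP` versus `VNP`.

References: [ForbesShpilkaVolk2018] §8; Nisan 1991 (partition matrices); planner valiant-natproofs-p1
g14 MEMO-thinrows-proofplan §9–§10 (twin collisions, collision law); prover g10 `…ChowThinRowsSubcube`;
val-np-p7 `…ChowThinSeparatingReduction`; this seat's memo HOME/prover/gen11/TWINPEEL-MEMO-g11.md.
-/

set_option linter.dupNamespace false

namespace Summit.ValiantsHypothesis.ValiantsHypothesis.Theorems.BarrierLever.ChowTwinPeel

open Finset MvPolynomial
open Summit.ValiantsHypothesis.ValiantsHypothesis.Theorems.BarrierLever.ChowSubcube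
  (coeff_empty_prod_nat)

variable {h : ℕ}

/-! ## 1. The recursion with both moves (single peel, pair peel), ending in the down-closure -/

/-- **THE TWIN-PEELING RECURSION WITH THE PAIR MOVE.**  Data: the successive column families
`𝒲s 0, 𝒲s 1, …, 𝒲s p` (given EXPLICITLY: `𝒲s (t+1)` is the `cs t`-peel of `𝒲s t`, enlarged by its
`ds t`-peels at the stages where the pair move is used), the peeled coordinates `cs t` (pairwise
distinct), the flags `pair t`, the auxiliary coordinates `ds t` and twin bases `w1 t`, `w2 t`.
Stage hypotheses: single stage — at most one twin pair along `cs t` in `𝒲s t` (base `w1 t`); pair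
stage — the twin bases along `cs t` are among the two columns `w1 t ∋ ds t`, `w2 t ∌ ds t`
(`cs t ≠ ds t`, `cs t ∉ w1 t, w2 t`).  Conclusion: a family `𝒦` of at most
`|downclosure (𝒲s p)| + Σ_{t<p} (1 or 2)` sets inside `(⋃ 𝒲s 0) ∪ {cs t}`, whose indicator forms
have SPAN on `𝒲s 0` and whose full product has POSITIVE INTEGER coefficients on `𝒲s 0`. -/
theorem exists_forms_of_peeling (p : ℕ) :
    ∀ (𝒲s : ℕ → Finset (Finset (Fin h))) (cs ds : ℕ → Fin h) (pair : ℕ → Bool)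
      (w1 w2 : ℕ → Finset (Fin h)),
      (∀ s, s < p → ∀ t, t < p → cs s = cs t → s = t) →
      (∀ t, t < p → pair t = false →
        𝒲s (t + 1) = (𝒲s t).image (fun W => W.erase (cs t)) ∧
        (∀ W ∈ 𝒲s t, cs t ∉ W → insert (cs t) W ∈ 𝒲s t → W = w1 t)) →
      (∀ t, t < p → pair t = true →
        𝒲s (t + 1) = (𝒲s t).image (fun W => W.erase (cs t)) ∪
          ((𝒲s t).image (fun W => W.erase (cs t))).image (fun W => W.erase (ds t)) ∧
        cs t ≠ ds t ∧ ds t ∈ w1 t ∧ ds t ∉ w2 t ∧ w1 t ∈ 𝒲s t ∧ w2 t ∈ 𝒲s t ∧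
        cs t ∉ w1 t ∧ cs t ∉ w2 t ∧
        (∀ W ∈ 𝒲s t, cs t ∉ W → insert (cs t) W ∈ 𝒲s t → W = w1 t ∨ W = w2 t)) →
      ∃ 𝒦 : Finset (Finset (Fin h)),
        𝒦.card ≤ ((𝒲s p).biUnion Finset.powerset).card +
          ∑ t ∈ Finset.range p, (if pair t = true then 2 else 1) ∧
        (∀ V ∈ 𝒦, V ⊆ (𝒲s 0).sup id ∪ (Finset.range p).image cs) ∧
        (∀ W ∈ 𝒲s 0, ∃ n : ℕ, 1 ≤ n ∧ coeff (∑ a ∈ (∅ : Finset (Fin h)), Finsupp.single (Fin.castAdd h a) 1 +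
        ∑ c' ∈ W, Finsupp.single (Fin.natAdd h c') 1) (∏ V ∈ 𝒦, (C 1 + ∑ a, C ((fun (_ : Fin h) (_ : Finset (Fin h)) => (0 : ℂ)) a V) *
        X (Fin.castAdd h a) + ∑ c', C (if c' ∈ V then (1 : ℂ) else 0) * X (Fin.natAdd h c') :
          MvPolynomial (Fin (h + h)) ℂ)) = (n : ℂ)) ∧
        (∀ g : Finset (Fin h) → ℂ, ∃ cV : Finset (Fin h) → ℂ, ∀ W ∈ 𝒲s 0,
          ∑ V ∈ 𝒦, cV V * coeff (∑ a ∈ (∅ : Finset (Fin h)), Finsupp.single (Fin.castAdd h a) 1 +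
        ∑ c' ∈ W, Finsupp.single (Fin.natAdd h c') 1) (∏ V' ∈ 𝒦.erase V, (C 1 + ∑ a, C ((fun (_ : Fin h) (_ : Finset (Fin h)) => (0 : ℂ)) a V') *
        X (Fin.castAdd h a) + ∑ c', C (if c' ∈ V' then (1 : ℂ) else 0) * X (Fin.natAdd h c') :
          MvPolynomial (Fin (h + h)) ℂ)) = g W) := by
  classical
  induction p with
  | zero =>
    intro 𝒲s cs ds pair w1 w2 _ _ _
    simp only [Finset.range_zero, Finset.sum_empty, add_zero, Finset.image_empty, Finset.union_empty]
    set DD : Finset (Finset (Fin h)) := (𝒲s 0).biUnion Finset.powerset with hDDdef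
    have hDD : ∀ W ∈ DD, ∀ U : Finset (Fin h), U ⊆ W → U ∈ DD := by
      intro W hW U hU
      rw [hDDdef, Finset.mem_biUnion] at hW ⊢
      obtain ⟨W', hW', hWW'⟩ := hW
      exact ⟨W', hW', Finset.mem_powerset.mpr (hU.trans (Finset.mem_powerset.mp hWW'))⟩
    have h𝒲 : ∀ W ∈ 𝒲s 0, W ∈ DD := fun W hW =>
      Finset.mem_biUnion.mpr ⟨W, hW, Finset.mem_powerset.mpr (subset_refl W)⟩
    refine ⟨DD, le_rfl, ?_, ?_, ?_⟩
    · intro V hV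
      rw [hDDdef, Finset.mem_biUnion] at hV
      obtain ⟨W, hW, hVW⟩ := hV
      exact (Finset.mem_powerset.mp hVW).trans (Finset.le_sup (f := id) hW)
    · intro W hW
      obtain ⟨n, hn, hn1⟩ := coeff_empty_prod_nat (fun (_ : Fin h) (_ : Finset (Fin h)) => (0 : ℂ)) DD W
      exact ⟨n, hn1 fun c hc => hDD W (h𝒲 W hW) {c} (Finset.singleton_subset_iff.mpr hc), hn⟩
    · intro g
      obtain ⟨cV, hcV⟩ := span_of_downClosed DD hDD g
      exact ⟨cV, fun W hW => hcV W (h𝒲 W hW)⟩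
  | succ p ih =>
    intro 𝒲s cs ds pair w1 w2 hinj hsingle hpair
    set c₀ : Fin h := cs 0 with hc₀
    -- the shifted data
    have hinj' : ∀ s, s < p → ∀ t, t < p → cs (s + 1) = cs (t + 1) → s = t := by
      intro s hs t ht hst
      have := hinj (s + 1) (by omega) (t + 1) (by omega) hst
      omega
    obtain ⟨𝒦', hcard', hsupp', hpos', hspan'⟩ := ih (fun t => 𝒲s (t + 1)) (fun t => cs (t + 1))
      (fun t => ds (t + 1)) (fun t => pair (t + 1)) (fun t => w1 (t + 1)) (fun t => w2 (t + 1)) hinj'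
      (fun t ht => hsingle (t + 1) (by omega)) (fun t ht => hpair (t + 1) (by omega))
    -- the family at stage 1 avoids `c₀`, and so do the old forms
    have h𝒲1 : ∀ W ∈ 𝒲s 1, c₀ ∉ W := by
      intro W hW
      cases hp0 : pair 0 with
      | false =>
        rw [(hsingle 0 (by omega) hp0).1, Finset.mem_image] at hW
        obtain ⟨W', _, rfl⟩ := hW
        exact Finset.notMem_erase c₀ W'
      | true =>
        rw [(hpair 0 (by omega) hp0).1, Finset.mem_union, Finset.mem_image, Finset.mem_image] at hW
        rcases hW with ⟨W', _, rfl⟩ | ⟨W', hW', rfl⟩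
        · exact Finset.notMem_erase c₀ W'
        · rw [Finset.mem_image] at hW'
          obtain ⟨W'', _, rfl⟩ := hW'
          exact fun hc => Finset.notMem_erase c₀ W'' (Finset.mem_of_mem_erase hc)
    have hfree : ∀ V ∈ 𝒦', c₀ ∉ V := by
      intro V hV hcV
      rcases Finset.mem_union.mp (hsupp' V hV hcV) with h1 | h2
      · rw [Finset.mem_sup] at h1
        obtain ⟨W', hW', hcW'⟩ := h1
        exact h𝒲1 W' hW' hcW'
      · rw [Finset.mem_image] at h2
        obtain ⟨s, hs, hcs⟩ := h2
        have := hinj (s + 1) (by rw [Finset.mem_range] at hs; omega) 0 (by omega) hcs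
        omega
    -- members of `𝒲s 1`
    have hmem1 : ∀ W ∈ 𝒲s 0, W.erase c₀ ∈ 𝒲s 1 := by
      intro W hW
      cases hp0 : pair 0 with
      | false =>
        rw [(hsingle 0 (by omega) hp0).1]
        exact Finset.mem_image_of_mem _ hW
      | true =>
        rw [(hpair 0 (by omega) hp0).1]
        exact Finset.mem_union_left _ (Finset.mem_image_of_mem _ hW)
    -- support bookkeeping
    have hsupp1 : (𝒲s 1).sup id ≤ (𝒲s 0).sup id := by
      refine Finset.sup_le fun W hW => ?_
      cases hp0 : pair 0 with
      | false =>
        rw [(hsingle 0 (by omega) hp0).1, Finset.mem_image] at hW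
        obtain ⟨W', hW', rfl⟩ := hW
        exact (Finset.erase_subset c₀ W').trans (Finset.le_sup (f := id) hW')
      | true =>
        rw [(hpair 0 (by omega) hp0).1, Finset.mem_union, Finset.mem_image, Finset.mem_image] at hW
        rcases hW with ⟨W', hW', rfl⟩ | ⟨W', hW', rfl⟩
        · exact (Finset.erase_subset c₀ W').trans (Finset.le_sup (f := id) hW')
        · rw [Finset.mem_image] at hW'
          obtain ⟨W'', hW'', rfl⟩ := hW'
          exact ((Finset.erase_subset _ _).trans (Finset.erase_subset c₀ W'')).trans
            (Finset.le_sup (f := id) hW'')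
    have hsuppK' : ∀ V ∈ 𝒦', V ⊆ (𝒲s 0).sup id ∪ (Finset.range (p + 1)).image cs := by
      intro V hV x hx
      rcases Finset.mem_union.mp (hsupp' V hV hx) with h1 | h2
      · exact Finset.mem_union_left _ (hsupp1 h1)
      · refine Finset.mem_union_right _ ?_
        rw [Finset.mem_image] at h2 ⊢
        obtain ⟨s, hs, hcs⟩ := h2
        exact ⟨s + 1, by rw [Finset.mem_range] at hs ⊢; omega, hcs⟩
    have hc₀mem : ({c₀} : Finset (Fin h)) ⊆ (𝒲s 0).sup id ∪ (Finset.range (p + 1)).image cs := by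
      intro x hx
      rw [Finset.mem_singleton] at hx
      subst hx
      exact Finset.mem_union_right _ (Finset.mem_image.mpr ⟨0, Finset.mem_range.mpr (by omega), rfl⟩)
    rw [Finset.sum_range_succ']
    cases hp0 : pair 0 with
    | false =>
      -- SINGLE MOVE at stage 0
      obtain ⟨_, htwin0⟩ := hsingle 0 (by omega) hp0
      refine ⟨insert {c₀} 𝒦', ?_, ?_, ?_, ?_⟩
      · rw [if_neg Bool.false_ne_true]
        exact (Finset.card_insert_le _ _).trans (by omega)
      · intro V hV
        rw [Finset.mem_insert] at hV
        rcases hV with rfl | hV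
        · exact hc₀mem
        · exact hsuppK' V hV
      · intro W hW
        obtain ⟨n, hn, e⟩ := hpos' (W.erase c₀) (hmem1 W hW)
        exact ⟨n, hn, by rw [coeff_prod_insert_singleton 𝒦' c₀ hfree W]; exact e⟩
      · refine span_insert_singleton 𝒦' c₀ hfree (𝒲s 0) (w1 0) htwin0 (fun W hW => ?_) ?_
        · obtain ⟨n, hn, e⟩ := hpos' (W.erase c₀) (hmem1 W hW)
          rw [e]; exact_mod_cast (by omega : n ≠ 0)
        · intro g
          obtain ⟨cV, hcV⟩ := hspan' g
          exact ⟨cV, fun W hW => hcV (W.erase c₀) (hmem1 W hW)⟩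
    | true =>
      -- PAIR MOVE at stage 0
      obtain ⟨h1eq, hcd, hdw1, hdw2, hw1, hw2, hcw1, hcw2, htwin0⟩ := hpair 0 (by omega) hp0
      set d₀ : Fin h := ds 0 with hd₀
      have hmem1d : ∀ W ∈ 𝒲s 0, (W.erase c₀).erase d₀ ∈ 𝒲s 1 := by
        intro W hW
        rw [h1eq]
        exact Finset.mem_union_right _ (Finset.mem_image_of_mem _ (Finset.mem_image_of_mem _ hW))
      refine ⟨insert (insert c₀ ({d₀} : Finset (Fin h))) (insert {c₀} 𝒦'), ?_, ?_, ?_, ?_⟩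
      · rw [if_pos rfl]
        exact (Finset.card_insert_le _ _).trans ((Nat.succ_le_succ (Finset.card_insert_le _ _)).trans
          (by omega))
      · intro V hV
        rw [Finset.mem_insert, Finset.mem_insert] at hV
        rcases hV with rfl | rfl | hV
        · intro x hx
          rw [Finset.mem_insert, Finset.mem_singleton] at hx
          rcases hx with rfl | rfl
          · exact hc₀mem (Finset.mem_singleton_self _)
          · exact Finset.mem_union_left _ (Finset.mem_sup.mpr ⟨w1 0, hw1, hdw1⟩)
        · exact hc₀mem
        · exact hsuppK' V hV
      · exact posNat_insert_pair 𝒦' c₀ d₀ hcd hfree (𝒲s 0) fun W hW => hpos' (W.erase c₀) (hmem1 W hW)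
      · refine span_insert_pair 𝒦' c₀ d₀ hcd hfree (𝒲s 0) (w1 0) (w2 0) hdw1 hdw2 htwin0 ?_ ?_ ?_
        · obtain ⟨n, hn, e⟩ := hpos' ((w1 0).erase d₀) (by
            have := hmem1d (w1 0) hw1
            rwa [Finset.erase_eq_of_notMem hcw1] at this)
          rw [e]; exact_mod_cast (by omega : n ≠ 0)
        · obtain ⟨n, hn, e⟩ := hpos' (w2 0) (by
            have := hmem1 (w2 0) hw2
            rwa [Finset.erase_eq_of_notMem hcw2] at this)
          rw [e]; exact_mod_cast (by omega : n ≠ 0)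
        · intro g
          obtain ⟨cV, hcV⟩ := hspan' g
          exact ⟨cV, fun W hW => hcV (W.erase c₀) (hmem1 W hW),
            fun W hW => hcV ((W.erase c₀).erase d₀) (hmem1d W hW)⟩

/-! ## 2. The slice theorem -/

/-- **MAIN THEOREM — the first-order-rows slice of item 20195 on every column family certified by
TWIN PEELING WITH THE PAIR MOVE, every height.**  Hypotheses as in `exists_forms_of_peeling` for the
family `𝒲s 0` containing the columns, plus the budget
`|downclosure (𝒲s p)| + Σ_{t<p} (2 if pair t else 1) ≤ h + h`.  Conclusion: item 20195's matrix
verbatim — every partition minor with injective rows of size `≤ 1` and injective columns in `𝒲s 0`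
is nonzero at one explicit product of `h + h` affine forms (indicator forms `1 + y_c`,
`1 + y_c + y_d`, those of the terminal down-closure, all with solved `x`-parts, and ones).
With the pair move every column family on `≤ 4` coordinates is certified at its minimal height
(seat census), e.g. the half-cubes of `2^[4]` at `h = 7` that parts I–III and the cross lemma left open. -/
theorem chowHits_firstOrderRows_of_peeling (h p : ℕ) (𝒲s : ℕ → Finset (Finset (Fin h)))
    (cs ds : ℕ → Fin h) (pair : ℕ → Bool) (w1 w2 : ℕ → Finset (Fin h))
    (hinj : ∀ s, s < p → ∀ t, t < p → cs s = cs t → s = t)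
    (hsingle : ∀ t, t < p → pair t = false →
      𝒲s (t + 1) = (𝒲s t).image (fun W => W.erase (cs t)) ∧
      (∀ W ∈ 𝒲s t, cs t ∉ W → insert (cs t) W ∈ 𝒲s t → W = w1 t))
    (hpair : ∀ t, t < p → pair t = true →
      𝒲s (t + 1) = (𝒲s t).image (fun W => W.erase (cs t)) ∪
        ((𝒲s t).image (fun W => W.erase (cs t))).image (fun W => W.erase (ds t)) ∧
      cs t ≠ ds t ∧ ds t ∈ w1 t ∧ ds t ∉ w2 t ∧ w1 t ∈ 𝒲s t ∧ w2 t ∈ 𝒲s t ∧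
      cs t ∉ w1 t ∧ cs t ∉ w2 t ∧
      (∀ W ∈ 𝒲s t, cs t ∉ W → insert (cs t) W ∈ 𝒲s t → W = w1 t ∨ W = w2 t))
    (hbudget : ((𝒲s p).biUnion Finset.powerset).card +
      ∑ t ∈ Finset.range p, (if pair t = true then 2 else 1) ≤ h + h)
    (r : ℕ) (u w : Fin r → Finset (Fin h))
    (hu : Function.Injective u) (hw : Function.Injective w)
    (hu1 : ∀ i, (u i).card ≤ 1) (hw𝒲 : ∀ j, w j ∈ 𝒲s 0) :
    ∃ ℓ : Fin (h + h) → MvPolynomial (Fin (h + h)) ℂ, (∀ k, (ℓ k).totalDegree ≤ 1) ∧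
      (Matrix.of fun i j : Fin r => MvPolynomial.coeff
        (∑ a ∈ u i, Finsupp.single (Fin.castAdd h a) 1 +
          ∑ c ∈ w j, Finsupp.single (Fin.natAdd h c) 1) (∏ k, ℓ k)).det ≠ 0 := by
  obtain ⟨𝒦, hcard, _, hpos, hspan⟩ :=
    exists_forms_of_peeling p 𝒲s cs ds pair w1 w2 hinj hsingle hpair
  refine chowHits_firstOrderRows_of_spanPos 𝒦 (𝒲s 0) (hcard.trans hbudget) (fun W hW => ?_) hspan
    r u w hu hw hu1 hw𝒲
  obtain ⟨n, hn, e⟩ := hpos W hW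
  rw [e]
  exact_mod_cast (by omega : n ≠ 0)

end Summit.ValiantsHypothesis.ValiantsHypothesis.Theorems.BarrierLever.ChowTwinPeel
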